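import Summits.HodgeConjecture.HodgeCM.Model.ToyG2.InputsWitness_1

/-! PORT of `HodgeCM/Model/ToyG2/InputsWitness.lean` (HodgeCMPerL run 82) — part 2: continuation of `Summits.HodgeConjecture.HodgeCM.Model.ToyG2.InputsWitness_1` (split at a top-level declaration boundary by port_pkg.py; scope re-opened below; declarations unchanged). -/

-- port_pkg: scope re-opened for this part (file-level context, then the namespace/section stack open at the cut)
set_option autoImplicit false
noncomputable section
namespace HodgeCM.ToyG2.InputsWitness
open HodgeCM.Toy HodgeCM.Toy.CMPresentation HodgeCM.ToyG2 HodgeCM.ToyG2.Obj₂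
open Literature.AlgebraicGeometry.Motives
open scoped TensorProduct
open exteriorPower
variable (L : CMField)
section Mor
variable {K L : CMField}
variable {ι₁ : L →+* ℂ} {V : HermSpace3 L ι₁}
/-- (Ported verbatim from the HodgeCMPerL package; no docstring in the source.) -/
lemma coordAt_single_ne {i i' : BIdx L} (h : i ≠ i') (τ' : FK L →+* ℂ) (y : ℂ ⊗[ℚ] FK L) :
    coordAt i τ' ((LinearMap.single ℚ (fam L) i').baseChange ℂ y) = 0 := by
  change ((epsBasis (F := FK L)).coord τ' ∘ₗ ((LinearMap.proj (R := ℚ) (φ := fam L) i).baseChange ℂ ∘ₗ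
    (LinearMap.single ℚ (fam L) i').baseChange ℂ)) y = _
  rw [← LinearMap.baseChange_comp, LinearMap.proj_comp_single_ne ℚ (fam L) i i' h, LinearMap.baseChange_zero]
  simp

/-- **the wedge of the two theta classes is non-zero**: `F_0^*(gen_σ) ∧ F_1^*(gen_σ) ≠ 0` for the classes through
the slots `idx₀ (indSet j Ψ₀)` (first copy) and `idx₁ (indSet j Ψ₁)` (second copy) -/
theorem cup_cls_ne_zero (Γ : Level V) (j : K →+* L) (Ψ₀ Ψ₁ : CMType K) (σ : K →+* ℂ) :
    USharp.cup2C (USharp.pms L ι₁ V Γ) 1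
      (cls Γ j Ψ₀ σ (idx₀ L (indSet j Ψ₀)) (setAt_idx₀ L _))
      (cls Γ j Ψ₁ σ (idx₁ L (indSet j Ψ₁)) (setAt_idx₁ L _)) ≠ 0 := by
  classical
  set y := extC (jT j) (eps (FK K) (embOf K σ)) with hy
  have hy0 : y ≠ 0 := fun h =>
    eps_ne_zero (embOf K σ) (extC_injective (jT j) (by rw [map_zero]; exact h))
  obtain ⟨τ₀, hτ₀⟩ : ∃ τ₀, (epsBasis (F := FK L)).repr y τ₀ ≠ 0 := by
    by_contra hall
    refine hy0 ((epsBasis (F := FK L)).repr.map_eq_zero_iff.mp (Finsupp.ext fun τ₀ => ?_))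
    exact not_not.mp fun h => hall ⟨τ₀, h⟩
  have hne : idx₁ L (indSet j Ψ₁) ≠ idx₀ L (indSet j Ψ₀) := fun h => idx₀_ne_idx₁ L _ _ h.symm
  have hw : ιMulti ℂ 2 ![vec j σ (idx₀ L (indSet j Ψ₀)), vec j σ (idx₁ L (indSet j Ψ₁))] ≠ 0 :=
    ιMulti_two_ne_zero _ _ (coordAt (idx₀ L (indSet j Ψ₀)) τ₀) (coordAt (idx₁ L (indSet j Ψ₁)) τ₀)
      (by rw [vec, coordAt_single_same]; exact hτ₀)
      (by rw [vec, coordAt_single_same]; exact hτ₀)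
      (by rw [vec, coordAt_single_ne hne])
  intro h0
  apply hw
  have hθ :
      ((BC.theta ℚ ℂ (blockObj L).L (1 + 1)
          (USharp.cup2C (USharp.pms L ι₁ V Γ) 1
            (cls Γ j Ψ₀ σ (idx₀ L (indSet j Ψ₀)) (setAt_idx₀ L _))
            (cls Γ j Ψ₁ σ (idx₁ L (indSet j Ψ₁)) (setAt_idx₁ L _))) : ⋀[ℂ]^(1 + 1) (blockObj L).LC) :
        ExteriorAlgebra ℂ (blockObj L).LC)
      = (BC.theta ℚ ℂ (blockObj L).L 1 (cls Γ j Ψ₀ σ (idx₀ L (indSet j Ψ₀)) (setAt_idx₀ L _)) :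
          ExteriorAlgebra ℂ (blockObj L).LC)
        * (BC.theta ℚ ℂ (blockObj L).L 1 (cls Γ j Ψ₁ σ (idx₁ L (indSet j Ψ₁)) (setAt_idx₁ L _)) :
          ExteriorAlgebra ℂ (blockObj L).LC) :=
    BC.theta_wedge ℚ ℂ (blockObj L).L 1 _ _
  have hz : BC.theta ℚ ℂ (blockObj L).L (1 + 1) (0 : USharp.CohC (USharp.pms L ι₁ V Γ) (1 + 1)) = 0 :=
    LinearMap.map_zero _
  rw [h0, hz, theta_cls, theta_cls, oneEquiv_symm_apply, oneEquiv_symm_apply] at hθ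
  apply Subtype.ext
  simp only [ιMulti_apply_coe, ExteriorAlgebra.ιMulti_apply, Submodule.coe_zero] at hθ ⊢
  simpa [List.ofFn_succ] using hθ.symm

end Mor

/-! ### 6. The null analytic side and the theta model `T♯` -/

section Model

open HodgeCM.Prior.Perl34File HodgeCM.Prior.Perl34File.Perl34

/-- the **null isolation core**: the Prior one-point core (`H = HG = CG = ℂ`, `G = SK = SigIdx = SigIdxG = Unit`,
`R` trivial, `σ̂ = ⊤`) with the theta kernels `𝒯_Φ := 0` -/
def nullCore : IsolationCore ℂ ℂ ℂ Unit Unit Unit Unit :=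
  { SmokeS4.core with TΦc := fun _ => 0 }

/-- (Ported verbatim from the HodgeCMPerL package; no docstring in the source.) -/
@[simp] lemma nullCore_TΦ_apply (Φ : Unit) (v : ℂ) : nullCore.TΦ Φ v = 0 := rfl

/-- (Ported verbatim from the HodgeCMPerL package; no docstring in the source.) -/
@[simp] lemma nullCore_inclCG_apply (v : ℂ) : nullCore.inclCG v = v := rfl

/-- (Ported verbatim from the HodgeCMPerL package; no docstring in the source.) -/
@[simp] lemma nullCore_R_apply (g : Unit) (v : ℂ) : nullCore.R g v = v := rfl

/-- the **null torus side**: `X = TestFn = Unit`, every character allowed, `ϑ ≡ 0`, `E ≡ 0`, `S₁₂ = ⊥`, `P_w = 0`,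
and the archimedean type `w` never occurs -/
def nullTorus : TorusData nullCore where
  X := Unit
  TestFn := Unit
  allowed := fun _ => True
  ϑc := fun _ _ => 0
  E := fun _ _ => 0
  S12 := ⊥
  S12_def := by
    refine le_antisymm bot_le (Submodule.topologicalClosure_minimal _ ?_ ?_)
    · rw [Submodule.span_le]
      rintro u ⟨χ, -, Φ, rfl⟩
      simp
    · rw [Submodule.bot_coe]
      exact isClosed_singleton
  wOccurs := fun _ => False
  Pw := 0
  Pw_idem := by simp
  Pw_selfAdjoint := fun _ _ => by simp
  AX5b_ϑ_cont := fun _ => continuous_const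
  AX12_transl_cont := fun _ _ => continuous_const
  ETransl := fun _ _ f => f
  AX12_E_transl := fun _ _ _ => rfl
  AX12_unfold_lift := fun _ _ _ => by
    rw [nullCore_TΦ_apply]
    exact Submodule.zero_mem _
  AX12_molly := fun _ _ => subset_closure ⟨(), by simp⟩
  AX8_annihilation := fun _ _ => rfl
  AX9_w_vector := fun _ _ _ _ hw _ => hw.elim

/-- **the theta model `T♯` over `U♯`.**  Geometric side GENUINE: the theta one-forms of type `Ψ_i` at level `Γ`
are ALL of `U_{Ψ_i}(Γ) = U_iso(Γ; K, Ψ_i, σ)` (the `B_{Ψ_i}`-isotypic `σ`-eigen holomorphic one-forms of the model),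
the coverings are identities (the surface object does not depend on the level), the sign recipe is
`κ(τ) = τ ∘ j` and the frame sign is the indicator of the standard CM type of `L`.  Analytic side NULL:
`L²`-spaces `ℂ`, `emb = 0`, the null core and the null torus on both sides. -/
def thetaSharp : USharp.ThetaModel where
  HG := fun _ _ _ => ℂ
  instHG₁ := fun _ _ _ => inferInstance
  instHG₂ := fun _ _ _ => inferInstance
  instHG₃ := fun _ _ _ => inferInstance
  emb := fun _ => 0
  cover := fun Γ _ _ => USharp.idMor (USharp.pms _ _ _ Γ)
  kappa := fun _ _ j _ τ => τ.comp j
  frameSign := fun L _ τ => decide (ind (stdCMType L) τ = 1)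
  H := fun _ _ => ℂ
  CG := fun _ _ => ℂ
  G := fun _ _ => Unit
  SK := fun _ _ => Unit
  SigIdx := fun _ _ => Unit
  SigIdxG := fun _ _ => Unit
  instH₁ := fun _ _ => inferInstance
  instH₂ := fun _ _ => inferInstance
  instH₃ := fun _ _ => inferInstance
  instCG₁ := fun _ _ => inferInstance
  instCG₂ := fun _ _ => inferInstance
  instG₁ := fun _ _ => inferInstance
  instG₂ := fun _ _ => inferInstance
  instSK := fun _ _ => inferInstance
  core := fun _ _ => nullCore
  t12 := fun _ _ => nullTorus
  t34 := fun _ _ => nullTorus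
  Theta := fun V c i Γ => (USharp.Uiso Γ c.K (c.Ψ i) c.σ : Set (USharp.CohC (USharp.pms _ _ V Γ) 1))

/-! ### 7. The inputs of `T♯`, its good contexts, and the consistency witness -/

/-- design constraint `κ(τ̄) = κ(τ)‾` -/
theorem thetaSharp_kappaConj : thetaSharp.Design_kappaConj := fun _ _ _ _ _ => rfl

/-- design constraint: the frame sign flips under conjugation (the defining property of the standard CM type) -/
theorem thetaSharp_frameSignConj : thetaSharp.Design_frameSignConj := by
  intro L ι₁ τ
  change decide (ind (stdCMType L) (NumberField.ComplexEmbedding.conjugate τ) = 1)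
    = !decide (ind (stdCMType L) τ = 1)
  have hΦ := (stdCMType L).2 τ
  by_cases h : τ ∈ (stdCMType L).1
  · have h' : NumberField.ComplexEmbedding.conjugate τ ∉ (stdCMType L).1 := hΦ.mp h
    simp [ind, h, h']
  · have h' : NumberField.ComplexEmbedding.conjugate τ ∈ (stdCMType L).1 := by
      by_contra h''
      exact h (hΦ.mpr h'')
    simp [ind, h, h']

/-- **good contexts of `T♯` exist** (Landherr's lemma is kernel-proved: `lemma33bLandherr_holds`; the context is the
face datum of `ℚ(ζ₇)` with Landherr's hermitian space and the constructed seesaw datum, `ThetaModel.exists_goodCtx`) -/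
theorem thetaSharp_exists_goodCtx :
    ∃ (L : CMField) (ι₁ : L →+* ℂ) (_ : HermSpace3 L ι₁) (c : SeesawCtx L), thetaSharp.GoodCtx ι₁ c :=
  thetaSharp.exists_goodCtx thetaSharp_kappaConj thetaSharp_frameSignConj lemma33bLandherr_holds

/-- `embCover` (both sides are `0`) -/
theorem thetaSharp_embCover : thetaSharp.Fact_embCover := fun _ _ _ _ => rfl

/-- `innerEmb` with `c_Γ = 1`: both sides vanish (`emb = 0`; the trace system of `U♯` is zero) -/
theorem thetaSharp_innerEmb : thetaSharp.Fact_innerEmb := by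
  intro L ι₁ V Γ
  refine ⟨1, one_ne_zero, fun η η' _ _ => ?_⟩
  have htr : USharp.trC (USharp.pms L ι₁ V Γ) 4 = 0 := USharp.periodFree_trC _ 4
  rw [htr, LinearMap.zero_apply, mul_zero]
  exact inner_zero_left _

/-- `thetaSub` (node N12) holds with equality: the theta one-forms ARE `U_{Ψ_i}(Γ)` -/
theorem thetaSharp_thetaSub : thetaSharp.Open_thetaSub := fun _ _ _ _ _ => subset_rfl

/-- **`thetaWedge` (node N33, PerL Prop 4.3) holds in `T♯`, non-vacuously**: in every good context, at the level-3
principal congruence level, the two theta one-forms `F_0^*(gen_σ) ∈ U_{Ψ₀}(Γ)`, `F_1^*(gen_σ) ∈ U_{Ψ₁}(Γ)` through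
the two copies of the atom of the induced types have non-zero cup product. -/
theorem thetaSharp_thetaWedge : thetaSharp.Open_thetaWedge := by
  intro L ι₁ V c hc
  obtain ⟨j, -, -⟩ := hc.forced
  exact ⟨Level.three V, _, cls_mem_uiso (Level.three V) j (hc.mem 0) _ (setAt_idx₀ L _), _,
    cls_mem_uiso (Level.three V) j (hc.mem 1) _ (setAt_idx₁ L _),
    cup_cls_ne_zero (Level.three V) j (c.Ψ 0) (c.Ψ 1) c.σ⟩

/-- `thetaGen12`: the wedge function is `emb (ω₁ ∪ ω₂) = 0 ∈ S₁₂` -/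
theorem thetaSharp_thetaGen12 : thetaSharp.Open_thetaGen12 :=
  fun _ _ _ _ _ _ _ _ => Submodule.zero_mem _

/-- `thetaReal34`: every generator `ϑ_{T',χ}(Φ)` is `0` -/
theorem thetaSharp_thetaReal34 : thetaSharp.Open_thetaReal34 :=
  fun _ _ _ _ _ _ => Submodule.zero_mem _

/-- `chars`: every character is allowed -/
theorem thetaSharp_chars : thetaSharp.Open_chars :=
  fun _ _ _ => ⟨fun _ => trivial, fun _ => trivial⟩

/-- `occ`: vacuous, the theta kernels are `0` -/
theorem thetaSharp_occ : thetaSharp.Open_occ := by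
  intro L ι₁ V c _
  refine ⟨fun Φ i h => ?_, fun Φ i h => ?_⟩ <;>
  · obtain ⟨v, -, hv⟩ := h
    exact (hv rfl).elim

/-- **all ten inputs of the theta model hold for `T♯`** -/
theorem thetaSharp_inputs : thetaSharp.Inputs where
  embCover := thetaSharp_embCover
  innerEmb := thetaSharp_innerEmb
  kappaConj := thetaSharp_kappaConj
  frameSignConj := thetaSharp_frameSignConj
  thetaSub := thetaSharp_thetaSub
  thetaWedge := thetaSharp_thetaWedge
  thetaGen12 := thetaSharp_thetaGen12
  thetaReal34 := thetaSharp_thetaReal34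
  chars := thetaSharp_chars
  occ := thetaSharp_occ

/-- **Hodge–Riemann `(2,0)` fails in `U♯`** — by the LANDED separation theorem
`Universe.periodFree_not_hodgeRiemann_of_thetaWedge` (its hypotheses `thetaSub`, `thetaWedge` and the two design
constraints are now DISCHARGED by `T♯`, Landherr's lemma by `lemma33bLandherr_holds`; `U♯` is its own period-free shadow). -/
theorem not_hodgeRiemann20 : ¬ USharp.Fact_hodgeRiemann20 :=
  USharp.periodFree_not_hodgeRiemann_of_thetaWedge uSharp_modelAxioms lemma33bLandherr_holds thetaSharp
    thetaSharp_kappaConj thetaSharp_frameSignConj thetaSharp_thetaSub thetaSharp_thetaWedge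

/-- **PerL (verbatim, `Universe.PerL`) fails in `U♯`** (`Universe.not_perL_periodFree`) -/
theorem not_perL : ¬ USharp.PerL := USharp.not_perL_periodFree

/-- … and so does PerL Thm 4.4 (`Universe.PerL44`) -/
theorem not_perL44 : ¬ USharp.PerL44 := USharp.not_perL44_periodFree

/-- **THE CONSISTENCY WITNESS.**  There are a universe satisfying all 28 model axioms and a theta model over it
satisfying ALL TEN typed inputs `ThetaModel.Inputs` (in particular node N33 = `Open_thetaWedge`, non-vacuously:
good contexts exist), in which Hodge–Riemann `(2,0)` and PerL both FAIL.  Consequently no assembly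
`ModelAxioms → Inputs → (good contexts) → PerL` can exist without a further hypothesis that fails in `U♯` — in the
tree's assemblies (`AssemblyRoutes.perL_of_*`, `perL_of_nodes''`) that hypothesis is `Fact_hodgeRiemann20` (h07). -/
theorem inputs_consistent :
    ∃ (U : Universe) (T : U.ThetaModel), U.ModelAxioms ∧ T.Inputs ∧
      (∃ (L : CMField) (ι₁ : L →+* ℂ) (_ : HermSpace3 L ι₁) (c : SeesawCtx L), T.GoodCtx ι₁ c) ∧
      ¬ U.Fact_hodgeRiemann20 ∧ ¬ U.PerL :=
  ⟨USharp, thetaSharp, uSharp_modelAxioms, thetaSharp_inputs, thetaSharp_exists_goodCtx, not_hodgeRiemann20,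
    not_perL⟩

/-! ### 8. Reading against the node assembly `PerL34.perL_of_nodes''` -/

/-- every typed-open-node hypothesis of `PerL34.perL_of_nodes''` OTHER than `h07` holds at `(U♯, T♯)` -/
theorem nodes_hold :
    PerL34.N09a_embCover thetaSharp ∧ PerL34.N09b_innerEmb thetaSharp ∧ PerL34.N12a_thetaSub thetaSharp ∧
      PerL34.N12b_signRecipe thetaSharp ∧ PerL34.N19w_wedgeMem thetaSharp ∧ PerL34.N19g_genInWedgeSpan thetaSharp ∧
      PerL34.N29_occ thetaSharp ∧ PerL34.N31_chars thetaSharp ∧ PerL34.N33_wedge thetaSharp :=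
  ⟨thetaSharp_embCover, thetaSharp_innerEmb, thetaSharp_thetaSub, ⟨thetaSharp_kappaConj, thetaSharp_frameSignConj⟩,
    thetaSharp_thetaGen12, thetaSharp_thetaReal34, thetaSharp_occ, thetaSharp_chars, thetaSharp_thetaWedge⟩

/-- the node assembly INSTANTIATED at `(U♯, T♯)`: there, PerL would follow from `h07` alone -/
theorem perL_of_h07 (h07 : PerL34.N07_hodgeRiemann20 USharp) : USharp.PerL :=
  PerL34.perL_of_nodes'' uSharp_modelAxioms thetaSharp h07 thetaSharp_embCover thetaSharp_innerEmb thetaSharp_thetaSub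
    ⟨thetaSharp_kappaConj, thetaSharp_frameSignConj⟩ thetaSharp_thetaGen12 thetaSharp_thetaReal34 thetaSharp_occ
    thetaSharp_chars thetaSharp_thetaWedge

/-- … whence `h07` FAILS at `U♯` — a second proof of `not_hodgeRiemann20`, through the assembly -/
theorem h07_fails : ¬ PerL34.N07_hodgeRiemann20 USharp := fun h07 => not_perL (perL_of_h07 h07)

/-- **`h07 : N07_hodgeRiemann20 U` cannot be deleted from `PerL34.perL_of_nodes''`**: the statement of that theorem
without `h07` is FALSE (witness `(U♯, T♯)`). -/
theorem h07_loadBearing :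
    ¬ ∀ (U : Universe) (T : U.ThetaModel), U.ModelAxioms → PerL34.N09a_embCover T → PerL34.N09b_innerEmb T →
        PerL34.N12a_thetaSub T → PerL34.N12b_signRecipe T → PerL34.N19w_wedgeMem T → PerL34.N19g_genInWedgeSpan T →
        PerL34.N29_occ T → PerL34.N31_chars T → PerL34.N33_wedge T → U.PerL :=
  fun h => not_perL (h USharp thetaSharp uSharp_modelAxioms thetaSharp_embCover thetaSharp_innerEmb thetaSharp_thetaSub
    ⟨thetaSharp_kappaConj, thetaSharp_frameSignConj⟩ thetaSharp_thetaGen12 thetaSharp_thetaReal34 thetaSharp_occ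
    thetaSharp_chars thetaSharp_thetaWedge)

/-- the same in `Inputs` form, with the non-vacuity clause: **the typed inputs of a theta model over a universe with the
28 model axioms, even with good contexts present, do not imply PerL** -/
theorem not_perL_of_inputs :
    ¬ ∀ (U : Universe) (T : U.ThetaModel), U.ModelAxioms → T.Inputs →
        (∃ (L : CMField) (ι₁ : L →+* ℂ) (_ : HermSpace3 L ι₁) (c : SeesawCtx L), T.GoodCtx ι₁ c) → U.PerL :=
  fun h => not_perL (h USharp thetaSharp uSharp_modelAxioms thetaSharp_inputs thetaSharp_exists_goodCtx)

/-! ### 9. With `h07`: the typed inputs force a non-trivial analytic side -/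

/-- **With Hodge–Riemann `(2,0)`, the typed inputs make the theta wedge `L²`-visible.**  Over a model of the 28 facts in
which `Fact_hodgeRiemann20` HOLDS, every theta model satisfying the ten typed inputs has, in some good context and at some
level, theta one-forms `ω₀ ∈ Θ(V,c,0,Γ)`, `ω₁ ∈ Θ(V,c,1,Γ)` whose wedge has NON-ZERO image under the Matsushima embedding:
`emb_Γ (ω₀ ∪ ω₁) ≠ 0` — PerL's mechanism (Prop 4.3 ⇒ `u₁ ∧ u₂ ≠ 0` in `L²`), here a consequence of `thetaSub` (the classes are
of type `(1,0)`), `thetaWedge`, `innerEmb` (Petersson = cup pairing) and `h07`.  KERNEL. -/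
theorem emb_wedge_ne_zero_of_inputs {U : Universe} (M : U.ModelAxioms) (h07 : U.Fact_hodgeRiemann20)
    (T : U.ThetaModel) (hI : T.Inputs) :
    ∃ (L : CMField) (ι₁ : L →+* ℂ) (V : HermSpace3 L ι₁) (c : SeesawCtx L) (Γ : Level V)
      (ω₀ ω₁ : U.CohC (U.pms L ι₁ V Γ) 1), T.GoodCtx ι₁ c ∧ ω₀ ∈ T.Theta V c 0 Γ ∧ ω₁ ∈ T.Theta V c 1 Γ ∧
        T.emb Γ (U.cup2C (U.pms L ι₁ V Γ) 1 ω₀ ω₁) ≠ 0 := by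
  obtain ⟨L, ι₁, V, c, hc⟩ := T.exists_goodCtx hI.kappaConj hI.frameSignConj lemma33bLandherr_holds
  obtain ⟨Γ, ω₀, h₀, ω₁, h₁, hne⟩ := hI.thetaWedge V c hc
  refine ⟨L, ι₁, V, c, Γ, ω₀, ω₁, hc, h₀, h₁, fun h0 => ?_⟩
  have hH10 : ∀ i, ∀ ω ∈ T.Theta V c i Γ, ω ∈ U.H10 (U.pms L ι₁ V Γ) :=
    fun i ω hω => U.Uiso_le_H10 M.pull_hodge Γ c.K (c.Ψ i) c.σ (hI.thetaSub V c hc i Γ hω)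
  have hF2 := Universe.cup2C_mem_F2 M _ (hH10 0 ω₀ h₀) (hH10 1 ω₁ h₁)
  obtain ⟨a, ha, hinner⟩ := hI.innerEmb Γ
  have key := hinner _ _ hF2 hF2
  rw [h0, inner_zero_left] at key
  exact h07 _ (M.pms_dim L ι₁ V Γ) _ hF2 hne ((mul_eq_zero.mp key.symm).resolve_left ha)

/-- Hence, over a model of the 28 facts satisfying `Fact_hodgeRiemann20`, **no theta model with null Matsushima embedding
(`emb = 0`, as in `T♯`) satisfies the typed inputs** — with `h07` present the inputs genuinely engage the analytic side
(through N09b `innerEmb`); without `h07` they do not (§7).  Consistent with §7–§8: `T♯` has `emb = 0`, and `h07` fails in `U♯`. -/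
theorem not_inputs_of_emb_eq_zero {U : Universe} (M : U.ModelAxioms) (h07 : U.Fact_hodgeRiemann20)
    (T : U.ThetaModel)
    (h0 : ∀ {L : CMField} {ι₁ : L →+* ℂ} {V : HermSpace3 L ι₁} (Γ : Level V), T.emb Γ = 0) : ¬ T.Inputs := by
  intro hI
  obtain ⟨L, ι₁, V, c, Γ, ω₀, ω₁, -, -, -, hne⟩ := emb_wedge_ne_zero_of_inputs M h07 T hI
  exact hne (by rw [h0 Γ, LinearMap.zero_apply])

/-- in particular (contrapositive at `U♯`): a third proof that `h07` fails in `U♯` -/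
example : ¬ USharp.Fact_hodgeRiemann20 :=
  fun h07 => not_inputs_of_emb_eq_zero uSharp_modelAxioms h07 thetaSharp (fun _ => rfl) thetaSharp_inputs

end Model

end HodgeCM.ToyG2.InputsWitness

end
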